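import Summits.QuantumFields.BalabanUV.T4Continuum.Spine.NE2.ComposedAveragingRate
import Summits.QuantumFields.BalabanUV.T4Continuum.Spine.NE2.DeltaPrimeSecondOrder

/-!
# T⁴ programme, spine node NE2 (U1a) — R15′: the composed-averaging END written with PRINT's (3.26) PRINCIPAL PART — `(principalB9 (R_k) (P_k) + Q_k(T_Bal)* a Q_k(T_Bal) + X_k)⁻¹`
# (cell `pub-balaban-gaps`, seat ne2 gen 4; census `run/shared/lean/pub/pub-balaban-gaps/ne/NE2.md` §12)

Gen 2's `DeltaPrimeSecondOrder.hodge_operator_eq_principalB9` rewrites ROOT B's Hodge-form operator as print's (3.26) principal part plus the free averaging plus the MODEL's averaging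
perturbation `avgPert` (the line-sum with product transporters) plus `X`.  THIS FILE is the same identity with the TABLE summand of W1/W2 in the B3 slot and the corollary of file 5's END:
 * **`freeAvg_add_avgPertT`**: `a·Q*Q ⊗ 1 + avgPertT T k = a·(n_k^d·Q_k(T_k)ᴴ)·Q_k(T_k)` — the free averaging plus the table summand IS print's (3.16)/(3.26) last term `Q*(U) a Q(U)` for
   ANY table (`Q* = n^dQᴴ` in `QvAdj`'s convention);
 * **`composed_operator_eq_principalB9`**: `Δ_a^{(k)}⊗1 + tierBPert (liftR R_b) (avgPertT T) (gaugeSlot + hodgeCorr + X) k = principalB9 (R_b k) (P_k) + a·(n_k^dQ_k(T_k)ᴴ)Q_k(T_k) + X k` (EXACT;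
   dictionary B0 `DictionaryB0.hodgeTierB_eq_principalB9` + unfolding);
 * **`principalB9_composed_rate`**: file 5's `ComposedAveragingRate.composed_averaging_rate` at the fourth slot `P₄ := gaugeSlot + hodgeCorr + X` REWRITTEN in print's vocabulary:
   `TowerLimitRate (Q⊗1) L^d (k ↦ (principalB9 (R_b k) (P_k) + a·(n_k^dQ_k(T_Bal)ᴴ)Q_k(T_Bal) + X k)⁻¹) (Cpert …) ρ`, `T_Bal = TBal (W^{(k)}) k` Bałaban's COMPOSED averaging of the DATA tower
   of averaged fields — i.e. «[(3.26)'s principal part at `R_b`] + [(3.15)/(3.16)'s composed `Q_k(U)* a Q_k(U)`] + [`X`: (3.10)'s `Δ′` or any fourth summand]» — CONDITIONAL on the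
   DISPLAYED law `hP₄` of that fourth slot at rate `ρ` (for `X = Δ′(V_k)` at `R_b = Ad∘V` gen 2's `GaugeTermSlotRegularRate` / `HodgeCorrectionLaws` / `DeltaPrimeSecondOrder.perturbationLaws_deltaPrime'`
   supply it at rate `L⁻¹ ≤ ρ`, not re-derived here), rows B5/NE3 (`hreg`, `hNE3` on `regClass (liftR R_b)`), the three data letters on `W`, and the threshold.
HONEST FRAMING (T4-DAG p. 1).  An exact identity + a rewriting of file 5's conditional END; MODEL LEVEL; `R_b`, `W`, `X` DATA with displayed letters; the coarse fields are NOT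
constructed from Bałaban's minimiser (F6 (ζ), G2 = NE3); rate `ρ ≥ 3/(2L)`; NOT NE2, NOT [B9] (3.26) as printed; NE2 (U1a) NOT PROVED; spine PROVED 0/9 unchanged; NOT continuum YM /
infinite volume / mass gap / Clay.  HONEST DEPENDENCY: continuum YM on T⁴ ⇐ BetaPertH ∧ nine spine estimates (0/9 proved); BetaPertH ⇐ (D1) ∧ (D4) ∧ CAP+tail; G-an2-4 gates asym,
D1 and NE2/3/4.  No `sorry`, no `def`.
-/

noncomputable section

open scoped BigOperators ComplexConjugate Matrix Matrix.Norms.L2Operator Kronecker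

namespace Summit.QuantumFields.BalabanUV.T4Continuum.NE2.ComposedAveragingPrincipal

open Literature.MathematicalPhysics.QuantumFieldTheory.Balaban1983to89.B5Prop11Plancherel (Tor fine Cst)
open Literature.MathematicalPhysics.QuantumFieldTheory.Balaban1983to89.B5Block118 (QvOp)
open Literature.MathematicalPhysics.QuantumFieldTheory.Balaban1983to89.B5DeltaA169 (QvAdj)
open Literature.MathematicalPhysics.QuantumFieldTheory.Balaban1983to89.B5G183RateUnitTower (lev)
open Literature.MathematicalPhysics.QuantumFieldTheory.Balaban1983to89.T4EtaRateMin (LocalRate)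
open Summit.QuantumFields.BalabanUV.T4Continuum
open Summit.QuantumFields.BalabanUV.T4Continuum.BalabanAveragedTowerUnit (idx Qlev)
open Summit.QuantumFields.BalabanUV.T4Continuum.KingPairingPlantedLaw (JpcT calDalev CJ)
open Summit.QuantumFields.BalabanUV.T4Continuum.GramPerturbationLaw (C2gram)
open Summit.QuantumFields.BalabanUV.T4Continuum.CovariantAveragingTower (TowerLimitRate)
open Summit.QuantumFields.BalabanUV.T4Continuum.BackgroundResolventTower (PerturbationLaws Cpert)
open Summit.QuantumFields.BalabanUV.T4Continuum.RegularBackgroundTower (RegularTransporters regClass)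
open Summit.QuantumFields.BalabanUV.T4Continuum.NE2FromNE3 (bgReadings)
open Summit.QuantumFields.BalabanUV.T4Continuum.CovariantAveragingSummand (kappaQ)
open Summit.QuantumFields.BalabanUV.T4Continuum.ColourCovariantLaplacian (covPertC)
open Summit.QuantumFields.BalabanUV.T4Continuum.WeitzenbockBridge (slotLift)
open Summit.QuantumFields.BalabanUV.T4Continuum.NE2BalabanLayer (tierBPert kappaB C2B)
open Summit.QuantumFields.BalabanUV.T4Continuum.NE2BalabanGauge (gaugeSlot liftR)
open Summit.QuantumFields.BalabanUV.T4Continuum.GaugeTermPerturbationLaw (gaugeTerm)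
open Summit.QuantumFields.BalabanUV.T4Continuum.HodgeCorrectionLaws (hodgeCorr)
open Summit.QuantumFields.BalabanUV.T4Continuum.GaugeTermScalarData (QuT Q1)
open Summit.QuantumFields.BalabanUV.T4Continuum.GaugeTermSandwichBound (projP)
open Summit.QuantumFields.BalabanUV.T4Continuum.GaugeTermLayer (Gop)
open Summit.QuantumFields.BalabanUV.T4Continuum.RegularSiteTransporters (siteT)
open Summit.QuantumFields.BalabanUV.T4Continuum.NE2.DictionaryB0 (principalB9 hodgeTierB_eq_principalB9)
open Summit.QuantumFields.BalabanUV.T4Continuum.NE2.CovariantTableAveraging (Table)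
open Summit.QuantumFields.BalabanUV.T4Continuum.NE2.CovariantTableTower (QcovLevT avgPertT)
open Summit.QuantumFields.BalabanUV.T4Continuum.NE2.CovariantTableBalaban (TBal)
open Summit.QuantumFields.BalabanUV.T4Continuum.NE2.ComposedAveragingMean (thetaZero)
open Summit.QuantumFields.BalabanUV.T4Continuum.NE2.ComposedAveragingRate (composed_averaging_rate)

variable {d : ℕ} (L : ℕ) [NeZero L] (M : Fin d → ℕ) [hM : ∀ μ, NeZero (M μ)] {o : Type*} [Fintype o] [DecidableEq o] (a : ℝ) (ha : 0 < a)

omit [NeZero L] in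
/-- **THE FREE AVERAGING PLUS THE TABLE SUMMAND IS PRINT's `Q*(U) a Q(U)` FOR ANY TABLE**: `a·Q*Q ⊗ 1 + avgPertT T k = a·(n_k^d·Q_k(T_k)ᴴ)·Q_k(T_k)` (exact).
[cite: Balaban1985BackgroundPropagators, (3.16) p.393, (3.26) p.395 (shape)] [folklore] -/
theorem freeAvg_add_avgPertT (T : (k : ℕ) → Table d (lev L k) M o) (k : ℕ) :
    ((a : ℂ) • (QvAdj (lev L k) M * QvOp (lev L k) M)) ⊗ₖ (1 : Matrix o o ℂ) + avgPertT L M a T k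
      = (a : ℂ) • (((((lev L k : ℕ) : ℂ) ^ d) • (QcovLevT L M T k)ᴴ) * QcovLevT L M T k) := by
  simp only [avgPertT, QvAdj, Matrix.smul_mul, Matrix.smul_kronecker, smul_sub]
  abel

variable [Nonempty o]

omit [Nonempty o] in
/-- **THE OPERATOR IDENTITY (dictionary B0 with the table slot)**: `Δ_a^{(k)}⊗1 + tierBPert (liftR R_b) (avgPertT T) (gaugeSlot + hodgeCorr + X) k
= principalB9 (R_b k) (P_k) + a·(n_k^dQ_k(T_k)ᴴ)Q_k(T_k) + X k` — EXACT, for any site-based transporters `R_b`, any table tower `T`, any fourth summand `X`.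
[cite: Balaban1985BackgroundPropagators, (3.26) p.395 (shape)] [folklore] -/
theorem composed_operator_eq_principalB9 (Rb : (k : ℕ) → Fin d → Tor (fine (lev L k) M) → Matrix o o ℂ) (T : (k : ℕ) → Table d (lev L k) M o)
    (X : (k : ℕ) → Matrix (idx L M k × o) (idx L M k × o) ℂ) {a' : ℝ} (ha' : 0 < a') (k : ℕ) :
    calDalev L M a ha k ⊗ₖ (1 : Matrix o o ℂ)
        + tierBPert L M (liftR L M Rb) (avgPertT L M a T)
            (fun k => gaugeSlot L M Rb (QuT L M o (siteT L M Rb)) (Q1 L M o) a' k + hodgeCorr L M Rb k + X k) k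
      = principalB9 (fine (lev L k) M) ((lev L k : ℕ) : ℂ) (Rb k)
          (projP (fine (lev L k) M) (Gop L M Rb (QuT L M o (siteT L M Rb)) a' k) (QuT L M o (siteT L M Rb) k))
        + (a : ℂ) • (((((lev L k : ℕ) : ℂ) ^ d) • (QcovLevT L M T k)ᴴ) * QcovLevT L M T k) + X k := by
  have hl : covPertC L M (liftR L M Rb) k = covPertC L M (fun k => slotLift (fine (lev L k) M) (Rb k)) k := rfl
  rw [← freeAvg_add_avgPertT L M a T k, ← add_assoc, ← hodgeTierB_eq_principalB9 L M a ha Rb (siteT L M Rb) ha' k, tierBPert, gaugeSlot, hl]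
  abel

/-- **THE COMPOSED-AVERAGING END IN PRINT's (3.26) VOCABULARY** (`L ≥ 2`, `d ≥ 1`, `max(θ_c, 3/(2L)) ≤ ρ < 1`): for site-based transporters `R_b` in row B5's class with NE3's `LocalRate`
on `regClass (liftR R_b)`, a DATA tower `W` of averaged fields (contractive; sizes `α/L^i`; consistency `σθ_c^k/L^i`, `i ≤ k`), and any fourth summand `X` whose slot law TOGETHER WITH the
gauge term and the Hodge correction is displayed at rate `ρ` (`hP₄`): the King-averaged colour covariances of
`(principalB9 (R_b k) (P_k) + a·(n_k^d Q_k(T_Bal)ᴴ)Q_k(T_Bal) + X k)⁻¹` — (3.26)'s principal part + (3.15)/(3.16)'s COMPOSED `Q_k(U)* a Q_k(U)` of the data tower + `X` — converge at rate `ρ^k`.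
For `R_b = Ad∘V`, `X = Δ′(V_k)` the law `hP₄` is supplied at rate `L⁻¹` by gen 2's files (`DeltaPrimeSecondOrder`, `HodgeCorrectionLaws`, `GaugeTermSlotRegularRate`); not re-derived here.
NE2 NOT proved. [cite: Balaban1985BackgroundPropagators, (3.15)–(3.16) p.393, (3.26) p.395 (shape); King1986, Lemma 4.5 (4.32)/(4.38) p.674 (template)] [folklore] -/
theorem principalB9_composed_rate (hL : 2 ≤ L) (hd : 1 ≤ d) {Rb : (k : ℕ) → Fin d → Tor (fine (lev L k) M) → Matrix o o ℂ} {αR βR : ℝ}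
    (hreg : RegularTransporters L M (liftR L M Rb) αR βR) {C : ℝ} (hC : 0 ≤ C) (hNE3 : LocalRate (bgReadings L M (regClass L M (liftR L M Rb))) C ((L : ℝ)⁻¹))
    {W : ℕ → (i : ℕ) → Fin d → (idx L M i → Matrix o o ℂ)} {α σ θc ρ : ℝ}
    (hα : 0 ≤ α) (hσ : 0 ≤ σ) (hθ0 : 0 ≤ θc) (hθ1 : θc ≤ 1) (hθρ : θc ≤ ρ) (hρ : 3 / (2 * (L : ℝ)) ≤ ρ) (hρ1 : ρ < 1)
    (hWn : ∀ k i ν b, ‖W k i ν b‖ ≤ 1) (hWa : ∀ k i ν b, ‖W k i ν b - 1‖ ≤ α / (lev L i : ℕ))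
    (hWc : ∀ k i ν b, i ≤ k → ‖W (k + 1) i ν b - W k i ν b‖ ≤ σ * θc ^ k / (lev L i : ℕ))
    {a' : ℝ} (ha' : 0 < a') {X : (k : ℕ) → Matrix (idx L M k × o) (idx L M k × o) ℂ} {κ₄ C₄ : ℝ}
    (hP₄ : PerturbationLaws (fun k => calDalev L M a ha k ⊗ₖ (1 : Matrix o o ℂ))
      (fun k => gaugeSlot L M Rb (QuT L M o (siteT L M Rb)) (Q1 L M o) a' k + hodgeCorr L M Rb k + X k)
      (fun k => JpcT L M k ⊗ₖ (1 : Matrix o o ℂ)) κ₄ (fun k => C₄ * ρ ^ k))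
    (hsmall : kappaB o d a αR βR C (kappaQ d a (a : ℂ) (Fintype.card o * (Real.exp ((((d + 1) * L : ℕ) : ℝ) * α) - 1))) κ₄ < 1) :
    TowerLimitRate (fun k => Qlev L M k ⊗ₖ (1 : Matrix o o ℂ)) ((L : ℝ) ^ d)
      (fun k => (principalB9 (fine (lev L k) M) ((lev L k : ℕ) : ℂ) (Rb k)
          (projP (fine (lev L k) M) (Gop L M Rb (QuT L M o (siteT L M Rb)) a' k) (QuT L M o (siteT L M Rb) k))
        + (a : ℂ) • (((((lev L k : ℕ) : ℂ) ^ d) • (QcovLevT L M (fun k => TBal L M (W k) k) k)ᴴ) * QcovLevT L M (fun k => TBal L M (W k) k) k)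
        + X k)⁻¹)
      (Cpert (kappaB o d a αR βR C (kappaQ d a (a : ℂ) (Fintype.card o * (Real.exp ((((d + 1) * L : ℕ) : ℝ) * α) - 1))) κ₄) (2 * d * Cst d a) (CJ d a)
        (C2B o d L a αR βR C
          (a * C2gram (Cst d a) 1 (Fintype.card o * (Real.exp ((((d + 1) * L : ℕ) : ℝ) * α) - 1)) (2 * d * Cst d a) (CJ d a) (Cst d a)
            (Cst d a * Fintype.card o * (thetaZero d L α σ + (Real.exp ((((d + 1) * L : ℕ) : ℝ) * α) - 1)))) C₄) 0 1) ρ := by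
  have h := composed_averaging_rate L M a ha hL hd hreg hC hNE3 hα hσ hθ0 hθ1 hθρ hρ hρ1 hWn hWa hWc hP₄ hsmall
  convert h using 3 with k
  rw [composed_operator_eq_principalB9 L M a ha Rb _ X ha' k]

end Summit.QuantumFields.BalabanUV.T4Continuum.NE2.ComposedAveragingPrincipal

end
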